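import Literature.AlgebraicGeometry.HodgeTheory.BettiHypersurfaceOffMiddleBettiNumbersPicardNumberOne
import Literature.AlgebraicGeometry.HodgeTheory.BettiPicardNumberOfProducts
import HarnessLib

/-!
# Hard-Lefschetz MONOTONICITY of the Hodge numbers of a fixed level (`h^{c+k, c−k}(H^{2c}X) ≤ h^{μ+k, μ−k}(H^{2μ}X)`, `c ≤ μ`, `c + μ ≤ dim X`): the top-degree level
# hypotheses of the numerical criteria for `HC(Y × Z)` imply the same vanishing in every lower degree; the converse bookkeeping (a non-zero morphism between
# transcendental parts forces a common level); Picard numbers of products with a smooth hypersurface (`q = 0`: `ρ(Y × Z) = ρ(Y) + ρ(Z)`, `= 1 + ρ(Z)` for `dim Y ≥ 3`)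
# (Voisin I §6.2.3 Thm. 6.25, Cor. 6.26, Rem. 6.27, §11.3.3 Thm. 11.38, Lemma 11.41; Voisin II §1.2.3 Cor. 1.24–1.25)

Family `hodge`, lane `lit-hodgefound` (Track 2 foundations library; Layers A1/A4), layer `Literature/AlgebraicGeometry/HodgeTheory`.  THEOREMS ONLY (no definition, no named fact,
no instance, no notation; D-0026 net debt `0`).  Prover seat `lit-hodgefound-p21` (generation 41, row g41-#6), sequel of the seat's g40-#5 `BettiTranscendentalPartMinimalityHodgeLevelProducts`
(`BettiUniverse.subsingleton_hom_transcendentalPart_twist_of_forall_hodgeNumber_mul_eq_zero`), g40-#7 `BettiHodgeConjectureProductsNumericalLevelCriterion` (whose docstring says «by hard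
Lefschetz the top degrees dominate the lower ones, so nothing is lost» — §1 here is that sentence as theorems) and g41-#5 `BettiHypersurfaceOffMiddleBettiNumbersPicardNumberOne`
(`ρ(Y) = 1` for a smooth hypersurface of dimension `≥ 3`); it uses the tree's `BettiHardLefschetzInequalities` (`BettiUniverse.hodgeNumber_hodge_le_of_add_le`, indexed by `(p, q, t)`) and
`BettiPicardNumberOfProducts` (`BettiUniverse.picardNumber_tensor_eq_add_of_irregularity_eq_zero_left/right`, which ASSUME `q = 0`).

THE MATHEMATICS.  (§1) Let `X` be smooth projective of dimension `n` and `L = ω ∧ ·`.  For `c ≤ μ` with `c + μ ≤ n`, hard Lefschetz (Thm. 6.25: `L^{n−2c}` is an isomorphism on `H^{2c}`,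
so `L^{μ−c}` is injective there) and `L` of bidegree `(1,1)` (Rem. 6.27) give `L^{μ−c} : H^{c+k, c−k}(X) ↪ H^{μ+k, μ−k}(X)`, i.e. **`h^{c+k, c−k}(H^{2c}X) ≤ h^{μ+k, μ−k}(H^{2μ}X)`** for every
level `k ≤ c`, and likewise **`h^{c+1+k, c−k}(H^{2c+1}X) ≤ h^{r+1+k, r−k}(H^{2r+1}X)`** for `c ≤ r`, `c + r + 1 ≤ n`.  Hence a level hypothesis in a TOP degree (`2μ ≤ n ≤ 2μ + 1`, resp.
`2r + 1 ≤ n ≤ 2r + 2`) — `h^{μ+k, μ−k}(X) = 0` — implies `h^{c+k, c−k}(H^{2c}X) = 0` for all `c ≤ μ` (for `k > c` the number vanishes for degree reasons), and a product hypothesis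
`h^{μ+k, μ−k}(Y) · h^{ν+k, ν−k}(Z) = 0` of the seat's LEVEL criterion (g40-#7) implies `h^{c+k, c−k}(H^{2c}Y) · h^{c'+k, c'−k}(H^{2c'}Z) = 0` for all `c ≤ μ`, `c' ≤ ν`: the top-degree
hypotheses are the strongest of their kind.  (§2) The contrapositive of g40-#5: for the transcendental parts `T^{2μ}(Y) = Hdg^μ(Y)^⊥`, `T ⊂ H^{2ν}(Z)`, **a non-zero morphism of Hodge structures
`T^{2μ}(Y) → T(ν − μ)` forces a common level `1 ≤ k ≤ min(μ, ν)` with `h^{μ+k, μ−k}(Y) ≠ 0` and `h^{ν+k, ν−k}(Z) ≠ 0`**; for `μ = 1` (a surface-like source): `h^{2,0}(Y) ≠ 0` and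
`h^{ν+1, ν−1}(Z) ≠ 0`.  (§3) A smooth hypersurface `Y ⊂ ℙ^{m+1}` of dimension `m ≥ 2` has `b₁(Y) = 0` (Cor. 1.24), so `q(Y) = h^{1,0}(Y) = 0` and the middle Künneth piece `H¹(Y) ⊗ H¹(Z)` of
`H²(Y × Z)` vanishes: by Thm. 11.38 / Lemma 11.41, **`ρ(Y × Z) = ρ(Y) + ρ(Z)`** for ANY smooth projective `Z` and any smooth-projective structure on `Y × Z`; for `m ≥ 3` moreover `ρ(Y) = 1`
(g41-#5), so **`ρ(Y × Z) = 1 + ρ(Z)`**, two such hypersurfaces `ρ = 2`, `Y ×` curve `ρ = 2`, `Y × S_d` (`S_d ⊂ ℙ³`) `ρ = 1 + ρ(S_d) ≤ 1 + h^{1,1}(S_d)`; `S_d × Z`: `ρ = ρ(S_d) + ρ(Z)`, two cubic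
surfaces `ρ = 14`, two quartic surfaces `ρ ≤ 40`.

THE PRINTS.  C. Voisin (2002) [VoisinHodgeI2002] §6.2.3 Thm. 6.25 (PDF p. 125–126), Cor. 6.26, Rem. 6.27 (PDF p. 126); §7.3.1 Def. 7.22 (PDF p. 147), Lemma 7.26 (PDF p. 148); §11.3.3
Thm. 11.38, Lemma 11.41 (PDF p. 236) and p. 287.  C. Voisin (2003) [VoisinHodgeII2003] §1.2.3 Cor. 1.24–1.25 (PDF p. 62).  D. Huybrechts (2016) [Huybrechts2016K3] Ch. 3 Def. 2.5, Lemma 3.1;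
Ch. 1 §2.3, §3.3.  Yu. G. Zarhin (1983) [Zarhin1983] §1.  K. Hulek, R. Laface (2019) [HulekLaface2019PicardNumbersAV] §2.1 Prop. 2.2.  D. Eisenbud, J. Harris (2016) [EisenbudHarris2016]
Example 5.24 and Table 5.1 (PDF p. 210–211).  D. Arapura (2012) [Arapura2012] §11.2 (PDF p. 177), §17.3 (17.3.1) (PDF p. 249).  No new mathematics is claimed.

THE OBJECTS (all the tree's).  `Hⁱ(X) = BettiUniverse.hodge hHD hX i`, `HodgeStructure.hodgeNumber`, `piece`, `hodgeClasses`, `Polarization`, `SubHodgeStructure`, `tateTwist`, `cast`, `Hom`;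
`BettiUniverse.hodgeNumber_hodge_le_of_add_le`, `BettiUniverse.piece_hodge_eq_bot_of_lt_left`, `BettiUniverse.piece_hodge_eq_bot_iff_hodgeNumber_eq_zero`,
`BettiUniverse.subsingleton_hom_transcendentalPart_twist_of_forall_hodgeNumber_mul_eq_zero`, `BettiUniverse.picardNumber_tensor_eq_add_of_irregularity_eq_zero_left/right`,
`BettiUniverse.picardNumber_curve`, `IsSmoothHypersurface.hodgeNumber_hodge_eq_zero_of_odd`, `IsSmoothHypersurface.finrank_hodgeClasses_hodge_two_eq_one`,
`IsSmoothHypersurface.finrank_hodgeClasses_two_surface_le`, `…_two_cubicSurface`, `…_two_quarticSurface_le`, `hodgeTensorFacts_holds`.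

WHAT IS PROVED.
* §1 **`BettiUniverse.hodgeNumber_hodge_even_level_le`**, **`BettiUniverse.hodgeNumber_hodge_odd_level_le`** (monotonicity in the degree at fixed level), **`BettiUniverse.hodgeNumber_hodge_even_level_eq_zero_of_top`**,
  **`…_odd_level_eq_zero_of_top`** (top-degree vanishing propagates down), **`BettiUniverse.hodgeNumber_mul_eq_zero_of_top_even`**, **`…_of_top_odd`** (the product hypotheses propagate down).
* §2 **`BettiUniverse.exists_hodgeNumber_ne_zero_of_nontrivial_hom_transcendentalPart`** (a non-zero `T^{2μ}(Y) → T(ν − μ)` forces a common level), `…_two` (`μ = 1`: `h^{2,0}(Y) ≠ 0` and `h^{ν+1,ν−1}(Z) ≠ 0`).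
* §3 **`IsSmoothHypersurface.irregularity_eq_zero`** (`q(Y) = 0`, `dim Y ≥ 2`), **`IsSmoothHypersurface.picardNumber_tensor_eq_add`** / `…_eq_add_right` (`ρ(Y × Z) = ρ(Y) + ρ(Z)`, `dim Y ≥ 2`, either order),
  **`IsSmoothHypersurface.picardNumber_tensor_eq_one_add`** / `…_eq_add_one` (`= 1 + ρ(Z)`, `dim Y ≥ 3`), `…picardNumber_tensor_eq_two` (two hypersurfaces of dimensions `≥ 3`), `…picardNumber_tensor_curve_eq_two`,
  `…picardNumber_tensor_surface_eq` / `…_le` (`Y × S_d`), `…picardNumber_surface_tensor_eq_add` (`S_d × Z`), `…picardNumber_tensor_cubicSurfaces` (`= 14`), `…picardNumber_tensor_quarticSurfaces_le` (`≤ 40`).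

## References
* [VoisinHodgeI2002] C. Voisin, *Hodge Theory and Complex Algebraic Geometry I* (2002) — §6.2.3 Thm. 6.25, Cor. 6.26, Rem. 6.27 (PDF p. 125–126); §7.3.1 Def. 7.22, Lemma 7.26; §11.3.3 Thm. 11.38, Lemma 11.41 (PDF p. 236), p. 287.
* [VoisinHodgeII2003] C. Voisin, *Hodge Theory and Complex Algebraic Geometry II* (2003) — §1.2.3 Cor. 1.24–1.25 (PDF p. 62).
* [Huybrechts2016K3] D. Huybrechts, *Lectures on K3 Surfaces* (2016) — Ch. 1 §2.3, §3.3; Ch. 3 Def. 2.5, Lemma 3.1.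
* [Zarhin1983] Yu. G. Zarhin, *Hodge groups of K3 surfaces*, J. reine angew. Math. 341 (1983) — §1.
* [HulekLaface2019PicardNumbersAV] K. Hulek, R. Laface, *On the Picard numbers of abelian varieties*, Ann. Sc. Norm. Super. Pisa (2019) — §2.1 Prop. 2.2.
* [EisenbudHarris2016] D. Eisenbud, J. Harris, *3264 and All That* (2016) — Example 5.24, Table 5.1 (PDF p. 210–211).
* [Arapura2012] D. Arapura, *Algebraic Geometry over the Complex Numbers* (2012) — §11.2 (PDF p. 177); §17.3 (17.3.1) (PDF p. 249).

## Provenance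
Lane `lit-hodgefound` (Hodge path, Track 2), prover seat `lit-hodgefound-p21` (generation 41), self-proposed row g41-#6 (sequel of g40-#5, g40-#7, g41-#5).
-/

noncomputable section

open scoped TensorProduct
open CategoryTheory MonoidalCategory Module Finset
open Literature.AlgebraicTopology.SingularHomology

namespace Literature.AlgebraicGeometry.HodgeTheory

open Literature.AlgebraicGeometry.Motives
open Literature.AlgebraicGeometry.Motives.HodgeStructure

variable {m n d : ℕ} {X Y Z : SchemeOver ℂ}

/-! ### §1 Hard-Lefschetz monotonicity of the Hodge numbers of a fixed level; top-degree vanishing propagates to every lower degree of the same parity -/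

section Monotonicity

/-- **`h^{c+k, c−k}(H^{2c}(X)) ≤ h^{μ+k, μ−k}(H^{2μ}(X))` for `c ≤ μ`, `c + μ ≤ dim X`, `k ≤ c`** (`L^{μ−c}` is injective on `H^{2c}` and of bidegree `(μ−c, μ−c)`; the tree's hard-Lefschetz
inequality `BettiUniverse.hodgeNumber_hodge_le_of_add_le`, re-indexed by degree and level). [cite: VoisinHodgeI2002, §6.2.3 Thm. 6.25, Cor. 6.26, Rem. 6.27 (PDF p. 125–126)] -/
theorem BettiUniverse.hodgeNumber_hodge_even_level_le (hHD : exists_isReal_hodgeModel) (hX : IsSmoothProjective n X) {c μ k : ℕ} (hcμ : c ≤ μ) (hμ : c + μ ≤ n) (hk : k ≤ c) :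
    (BettiUniverse.hodge hHD hX (2 * c)).hodgeNumber ((c : ℤ) + k) ((c : ℤ) - k) ≤ (BettiUniverse.hodge hHD hX (2 * μ)).hodgeNumber ((μ : ℤ) + k) ((μ : ℤ) - k) := by
  have h := BettiUniverse.hodgeNumber_hodge_le_of_add_le hHD hX (p := c + k) (q := c - k) (t := μ - c) (by omega)
  rw [show c + k + (c - k) = 2 * c by omega, show c + k + (μ - c) + (c - k + (μ - c)) = 2 * μ by omega] at h
  have e1 : ((c + k : ℕ) : ℤ) = (c : ℤ) + k := by push_cast; ring
  have e2 : ((c - k : ℕ) : ℤ) = (c : ℤ) - k := by push_cast [hk]; ring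
  have e3 : ((c + k + (μ - c) : ℕ) : ℤ) = (μ : ℤ) + k := by push_cast [hcμ]; ring
  have e4 : ((c - k + (μ - c) : ℕ) : ℤ) = (μ : ℤ) - k := by push_cast [hk, hcμ]; ring
  rwa [e1, e2, e3, e4] at h

/-- **`h^{c+1+k, c−k}(H^{2c+1}(X)) ≤ h^{r+1+k, r−k}(H^{2r+1}(X))` for `c ≤ r`, `c + r + 1 ≤ dim X`, `k ≤ c`** (the odd degrees). [cite: VoisinHodgeI2002, §6.2.3 Thm. 6.25, Cor. 6.26, Rem. 6.27 (PDF p. 125–126)] -/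
theorem BettiUniverse.hodgeNumber_hodge_odd_level_le (hHD : exists_isReal_hodgeModel) (hX : IsSmoothProjective n X) {c r k : ℕ} (hcr : c ≤ r) (hr : c + r + 1 ≤ n) (hk : k ≤ c) :
    (BettiUniverse.hodge hHD hX (2 * c + 1)).hodgeNumber ((c : ℤ) + 1 + k) ((c : ℤ) - k) ≤ (BettiUniverse.hodge hHD hX (2 * r + 1)).hodgeNumber ((r : ℤ) + 1 + k) ((r : ℤ) - k) := by
  have h := BettiUniverse.hodgeNumber_hodge_le_of_add_le hHD hX (p := c + 1 + k) (q := c - k) (t := r - c) (by omega)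
  rw [show c + 1 + k + (c - k) = 2 * c + 1 by omega, show c + 1 + k + (r - c) + (c - k + (r - c)) = 2 * r + 1 by omega] at h
  have e1 : ((c + 1 + k : ℕ) : ℤ) = (c : ℤ) + 1 + k := by push_cast; ring
  have e2 : ((c - k : ℕ) : ℤ) = (c : ℤ) - k := by push_cast [hk]; ring
  have e3 : ((c + 1 + k + (r - c) : ℕ) : ℤ) = (r : ℤ) + 1 + k := by push_cast [hcr]; ring
  have e4 : ((c - k + (r - c) : ℕ) : ℤ) = (r : ℤ) - k := by push_cast [hk, hcr]; ring
  rwa [e1, e2, e3, e4] at h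

/-- **Vanishing in the even degree `2μ` propagates down: `h^{μ+k, μ−k}(H^{2μ}X) = 0 ⟹ h^{c+k, c−k}(H^{2c}X) = 0`** for `c ≤ μ`, `c + μ ≤ dim X` (for `k > c` the lower number vanishes for
degree reasons). [cite: VoisinHodgeI2002, §6.2.3 Thm. 6.25, Cor. 6.26, Rem. 6.27 (PDF p. 125–126)] -/
theorem BettiUniverse.hodgeNumber_hodge_even_level_eq_zero_of_top (hHD : exists_isReal_hodgeModel) (hX : IsSmoothProjective n X) {c μ k : ℕ} (hcμ : c ≤ μ) (hμ : c + μ ≤ n)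
    (h : (BettiUniverse.hodge hHD hX (2 * μ)).hodgeNumber ((μ : ℤ) + k) ((μ : ℤ) - k) = 0) : (BettiUniverse.hodge hHD hX (2 * c)).hodgeNumber ((c : ℤ) + k) ((c : ℤ) - k) = 0 := by
  by_cases hk : k ≤ c
  · exact Nat.le_zero.1 ((BettiUniverse.hodgeNumber_hodge_even_level_le hHD hX hcμ hμ hk).trans h.le)
  · rw [← BettiUniverse.piece_hodge_eq_bot_iff_hodgeNumber_eq_zero]
    exact BettiUniverse.piece_hodge_eq_bot_of_lt_left hHD hX (2 * c) _ (by push_cast; omega)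

/-- **Vanishing in the odd degree `2r+1` propagates down: `h^{r+1+k, r−k}(H^{2r+1}X) = 0 ⟹ h^{c+1+k, c−k}(H^{2c+1}X) = 0`** for `c ≤ r`, `c + r + 1 ≤ dim X`.
[cite: VoisinHodgeI2002, §6.2.3 Thm. 6.25, Cor. 6.26, Rem. 6.27 (PDF p. 125–126)] -/
theorem BettiUniverse.hodgeNumber_hodge_odd_level_eq_zero_of_top (hHD : exists_isReal_hodgeModel) (hX : IsSmoothProjective n X) {c r k : ℕ} (hcr : c ≤ r) (hr : c + r + 1 ≤ n)
    (h : (BettiUniverse.hodge hHD hX (2 * r + 1)).hodgeNumber ((r : ℤ) + 1 + k) ((r : ℤ) - k) = 0) :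
    (BettiUniverse.hodge hHD hX (2 * c + 1)).hodgeNumber ((c : ℤ) + 1 + k) ((c : ℤ) - k) = 0 := by
  by_cases hk : k ≤ c
  · exact Nat.le_zero.1 ((BettiUniverse.hodgeNumber_hodge_odd_level_le hHD hX hcr hr hk).trans h.le)
  · rw [← BettiUniverse.piece_hodge_eq_bot_iff_hodgeNumber_eq_zero]
    exact BettiUniverse.piece_hodge_eq_bot_of_lt_left hHD hX (2 * c + 1) _ (by push_cast; omega)

/-- **The even product hypotheses of the numerical level criterion propagate down**: if `h^{μ+k, μ−k}(Y) · h^{ν+k, ν−k}(Z) = 0` in the even degrees `2μ ≤ dim Y`, `2ν ≤ dim Z`, then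
`h^{c+k, c−k}(H^{2c}Y) · h^{c'+k, c'−k}(H^{2c'}Z) = 0` for all `c ≤ μ`, `c' ≤ ν` (the top-degree hypotheses of the seat's g40-#7 `BettiUniverse.hodgeConjectureFor_tensor_of_forall_hodgeNumber_mul_eq_zero`
are the strongest of their kind — «by hard Lefschetz the top degrees dominate the lower ones»). [cite: VoisinHodgeI2002, §6.2.3 Thm. 6.25, Rem. 6.27 (PDF p. 125–126) and §11.3.3 Lemma 11.41 (PDF p. 236)] -/
theorem BettiUniverse.hodgeNumber_mul_eq_zero_of_top_even (hHD : exists_isReal_hodgeModel) (hY : IsSmoothProjective m Y) (hZ : IsSmoothProjective n Z) {μ ν : ℕ} (hμ : 2 * μ ≤ m) (hν : 2 * ν ≤ n)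
    {k : ℕ} (h : (BettiUniverse.hodge hHD hY (2 * μ)).hodgeNumber ((μ : ℤ) + k) ((μ : ℤ) - k) * (BettiUniverse.hodge hHD hZ (2 * ν)).hodgeNumber ((ν : ℤ) + k) ((ν : ℤ) - k) = 0) {c c' : ℕ}
    (hc : c ≤ μ) (hc' : c' ≤ ν) :
    (BettiUniverse.hodge hHD hY (2 * c)).hodgeNumber ((c : ℤ) + k) ((c : ℤ) - k) * (BettiUniverse.hodge hHD hZ (2 * c')).hodgeNumber ((c' : ℤ) + k) ((c' : ℤ) - k) = 0 := by
  rcases mul_eq_zero.1 h with h0 | h0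
  · rw [BettiUniverse.hodgeNumber_hodge_even_level_eq_zero_of_top hHD hY hc (by omega) h0, zero_mul]
  · rw [BettiUniverse.hodgeNumber_hodge_even_level_eq_zero_of_top hHD hZ hc' (by omega) h0, mul_zero]

/-- **The odd product hypotheses propagate down**: `h^{r+1+k, r−k}(Y) · h^{t+1+k, t−k}(Z) = 0` in the odd degrees `2r+1 ≤ dim Y`, `2t+1 ≤ dim Z` ⟹ the same in every lower pair of odd degrees
`2c+1`, `2c'+1` (`c ≤ r`, `c' ≤ t`). [cite: VoisinHodgeI2002, §6.2.3 Thm. 6.25, Rem. 6.27 (PDF p. 125–126) and §11.3.3 Lemma 11.41 (PDF p. 236)] -/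
theorem BettiUniverse.hodgeNumber_mul_eq_zero_of_top_odd (hHD : exists_isReal_hodgeModel) (hY : IsSmoothProjective m Y) (hZ : IsSmoothProjective n Z) {r t : ℕ} (hr : 2 * r + 1 ≤ m)
    (ht : 2 * t + 1 ≤ n) {k : ℕ}
    (h : (BettiUniverse.hodge hHD hY (2 * r + 1)).hodgeNumber ((r : ℤ) + 1 + k) ((r : ℤ) - k) * (BettiUniverse.hodge hHD hZ (2 * t + 1)).hodgeNumber ((t : ℤ) + 1 + k) ((t : ℤ) - k) = 0) {c c' : ℕ}
    (hc : c ≤ r) (hc' : c' ≤ t) :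
    (BettiUniverse.hodge hHD hY (2 * c + 1)).hodgeNumber ((c : ℤ) + 1 + k) ((c : ℤ) - k) * (BettiUniverse.hodge hHD hZ (2 * c' + 1)).hodgeNumber ((c' : ℤ) + 1 + k) ((c' : ℤ) - k) = 0 := by
  rcases mul_eq_zero.1 h with h0 | h0
  · rw [BettiUniverse.hodgeNumber_hodge_odd_level_eq_zero_of_top hHD hY hc (by omega) h0, zero_mul]
  · rw [BettiUniverse.hodgeNumber_hodge_odd_level_eq_zero_of_top hHD hZ hc' (by omega) h0, mul_zero]

end Monotonicity

/-! ### §2 The converse bookkeeping: a non-zero morphism between transcendental parts forces a common Hodge level -/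

section Converse

/-- **A non-zero morphism of Hodge structures `T^{2μ}(Y) → T(ν − μ)` (`T^{2μ}(Y) = Hdg^μ(Y)^⊥` the transcendental part, `T ⊂ H^{2ν}(Z)` any sub-Hodge structure) forces a common level:
some `1 ≤ k ≤ min(μ, ν)` with `h^{μ+k, μ−k}(Y) ≠ 0` AND `h^{ν+k, ν−k}(Z) ≠ 0`** — the contrapositive of the seat's g40-#5 `BettiUniverse.subsingleton_hom_transcendentalPart_twist_of_forall_hodgeNumber_mul_eq_zero`.
[cite: Huybrechts2016K3, Ch. 3 Def. 2.5 and Lemma 3.1] [cite: Zarhin1983, §1] [cite: VoisinHodgeI2002, §7.3.1 Def. 7.22 (PDF p. 147), Lemma 7.26 (PDF p. 148)] -/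
theorem BettiUniverse.exists_hodgeNumber_ne_zero_of_nontrivial_hom_transcendentalPart (hHD : exists_isReal_hodgeModel) (hY : IsSmoothProjective m Y) (hZ : IsSmoothProjective n Z) {μ ν : ℕ}
    (ψY : Polarization (BettiUniverse.hodge hHD hY (2 * μ))) {TY : SubHodgeStructure (BettiUniverse.hodge hHD hY (2 * μ))}
    (hTY : TY.toSubmodule = ψY.form.orthogonal ((BettiUniverse.hodge hHD hY (2 * μ)).hodgeClasses μ)) (TZ : SubHodgeStructure (BettiUniverse.hodge hHD hZ (2 * ν))) {s' : ℤ}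
    (hs' : ((2 * ν : ℕ) : ℤ) - 2 * s' = ((2 * μ : ℕ) : ℤ)) (hne : Nontrivial (Hom TY.toHodgeStructure ((TZ.toHodgeStructure.tateTwist s').cast hs'))) :
    ∃ k : ℕ, 1 ≤ k ∧ k ≤ μ ∧ k ≤ ν ∧ (BettiUniverse.hodge hHD hY (2 * μ)).hodgeNumber ((μ : ℤ) + k) ((μ : ℤ) - k) ≠ 0 ∧ (BettiUniverse.hodge hHD hZ (2 * ν)).hodgeNumber ((ν : ℤ) + k) ((ν : ℤ) - k) ≠ 0 := by
  by_contra hcon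
  push Not at hcon
  have hsub := BettiUniverse.subsingleton_hom_transcendentalPart_twist_of_forall_hodgeNumber_mul_eq_zero hHD hY hZ ψY hTY TZ hs' fun k hk1 hkμ hkν ↦ by
    by_cases h0 : (BettiUniverse.hodge hHD hY (2 * μ)).hodgeNumber ((μ : ℤ) + k) ((μ : ℤ) - k) = 0
    · rw [h0, zero_mul]
    · rw [hcon k hk1 hkμ hkν h0, mul_zero]
  exact not_nontrivial_iff_subsingleton.2 hsub hne

/-- **The case `μ = 1` (transcendental part of `H²`): a non-zero morphism of Hodge structures `T²(Y) → T(ν − 1)`, `T ⊂ H^{2ν}(Z)`, forces `h^{2,0}(Y) ≠ 0` AND `h^{ν+1, ν−1}(Z) ≠ 0`.**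
[cite: Huybrechts2016K3, Ch. 3 Def. 2.5 and Lemma 3.1] [cite: Zarhin1983, §1] [cite: VoisinHodgeI2002, §7.3.1 Def. 7.22 (PDF p. 147), Lemma 7.26 (PDF p. 148)] -/
theorem BettiUniverse.hodgeNumber_two_zero_ne_zero_of_nontrivial_hom_transcendentalPart (hHD : exists_isReal_hodgeModel) (hY : IsSmoothProjective m Y) (hZ : IsSmoothProjective n Z) {ν : ℕ}
    (ψY : Polarization (BettiUniverse.hodge hHD hY (2 * 1))) {TY : SubHodgeStructure (BettiUniverse.hodge hHD hY (2 * 1))}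
    (hTY : TY.toSubmodule = ψY.form.orthogonal ((BettiUniverse.hodge hHD hY (2 * 1)).hodgeClasses 1)) (TZ : SubHodgeStructure (BettiUniverse.hodge hHD hZ (2 * ν))) {s' : ℤ}
    (hs' : ((2 * ν : ℕ) : ℤ) - 2 * s' = ((2 * 1 : ℕ) : ℤ)) (hne : Nontrivial (Hom TY.toHodgeStructure ((TZ.toHodgeStructure.tateTwist s').cast hs'))) :
    (BettiUniverse.hodge hHD hY (2 * 1)).hodgeNumber 2 0 ≠ 0 ∧ (BettiUniverse.hodge hHD hZ (2 * ν)).hodgeNumber ((ν : ℤ) + 1) ((ν : ℤ) - 1) ≠ 0 := by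
  obtain ⟨k, hk1, hkμ, -, hY0, hZ0⟩ := BettiUniverse.exists_hodgeNumber_ne_zero_of_nontrivial_hom_transcendentalPart hHD hY hZ ψY hTY TZ hs' hne
  obtain rfl : k = 1 := le_antisymm hkμ hk1
  exact ⟨by simpa using hY0, by simpa using hZ0⟩

end Converse

end Literature.AlgebraicGeometry.HodgeTheory

namespace Literature.AlgebraicGeometry.Motives.IsSmoothHypersurface

open Literature.AlgebraicGeometry.Motives
open Literature.AlgebraicGeometry.Motives.HodgeStructure
open Literature.AlgebraicGeometry.HodgeTheory

variable {m n e d k : ℕ} {X Y Z C S : SchemeOver ℂ}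

/-! ### §3 Picard numbers of products with a smooth hypersurface: `q(Y) = 0`, `ρ(Y × Z) = ρ(Y) + ρ(Z)` (`dim Y ≥ 2`), `= 1 + ρ(Z)` (`dim Y ≥ 3`) -/

section Picard

/-- **`q(Y) = h^{1,0}(Y) = 0` for a smooth hypersurface `Y ⊂ ℙ^{m+1}` of dimension `m ≥ 2`** (`b₁(Y) = 0`, Lefschetz). [cite: VoisinHodgeII2003, §1.2.3 Cor. 1.24 and Cor. 1.25 (PDF p. 62)] -/
theorem irregularity_eq_zero (hYh : IsSmoothHypersurface m e Y) (hm : 2 ≤ m) (hHD : exists_isReal_hodgeModel) (hX : IsSmoothProjective m Y) :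
    (BettiUniverse.hodge hHD hX 1).hodgeNumber 1 0 = 0 := by
  exact_mod_cast hYh.hodgeNumber_hodge_eq_zero_of_odd hHD hX odd_one (by omega) (p := 1) (q := 0) rfl

/-- **`ρ(Y × Z) = ρ(Y) + ρ(Z)` for a smooth hypersurface `Y` of dimension `m ≥ 2` and any smooth projective `Z`** (any smooth-projective structure on `Y × Z`; no `H¹(Y) ⊗ H¹(Z)` contribution
since `q(Y) = 0`: the tree's `BettiUniverse.picardNumber_tensor_eq_add_of_irregularity_eq_zero_left`). [cite: VoisinHodgeI2002, §11.3.3 Thm. 11.38 and Lemma 11.41 (PDF p. 236), p. 287]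
[cite: VoisinHodgeII2003, §1.2.3 Cor. 1.24 (PDF p. 62)] [cite: HulekLaface2019PicardNumbersAV, §2.1 Prop. 2.2] -/
theorem picardNumber_tensor_eq_add (hYh : IsSmoothHypersurface m e Y) (hm : 2 ≤ m) (hHD : exists_isReal_hodgeModel) (hZ : IsSmoothProjective n Z) (hYZ : IsSmoothProjective k (Y ⊗ Z)) :
    Module.finrank ℚ ↥((BettiUniverse.hodge hHD hYZ 2).hodgeClasses 1) =
      Module.finrank ℚ ↥((BettiUniverse.hodge hHD hYh.1 2).hodgeClasses 1) + Module.finrank ℚ ↥((BettiUniverse.hodge hHD hZ 2).hodgeClasses 1) := by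
  haveI : HodgeTensorFacts.{0, 0} := hodgeTensorFacts_holds
  exact BettiUniverse.picardNumber_tensor_eq_add_of_irregularity_eq_zero_left hHD hYh.1 hZ hYZ (hYh.irregularity_eq_zero hm hHD hYh.1)

/-- **`ρ(Z × Y) = ρ(Z) + ρ(Y)`**, the hypersurface `Y` (`dim ≥ 2`) on the right. [cite: VoisinHodgeI2002, §11.3.3 Thm. 11.38 and Lemma 11.41 (PDF p. 236), p. 287] [cite: VoisinHodgeII2003, §1.2.3 Cor. 1.24 (PDF p. 62)] -/
theorem picardNumber_tensor_eq_add_right (hYh : IsSmoothHypersurface m e Y) (hm : 2 ≤ m) (hHD : exists_isReal_hodgeModel) (hZ : IsSmoothProjective n Z) (hZY : IsSmoothProjective k (Z ⊗ Y)) :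
    Module.finrank ℚ ↥((BettiUniverse.hodge hHD hZY 2).hodgeClasses 1) =
      Module.finrank ℚ ↥((BettiUniverse.hodge hHD hZ 2).hodgeClasses 1) + Module.finrank ℚ ↥((BettiUniverse.hodge hHD hYh.1 2).hodgeClasses 1) := by
  haveI : HodgeTensorFacts.{0, 0} := hodgeTensorFacts_holds
  exact BettiUniverse.picardNumber_tensor_eq_add_of_irregularity_eq_zero_right hHD hZ hYh.1 hZY (hYh.irregularity_eq_zero hm hHD hYh.1)

/-- **`ρ(Y × Z) = 1 + ρ(Z)` for a smooth hypersurface `Y` of dimension `m ≥ 3`** (`ρ(Y) = 1`, the seat's g41-#5 `finrank_hodgeClasses_hodge_two_eq_one`). [cite: VoisinHodgeI2002, §11.3.3 Thm. 11.38 and Lemma 11.41 (PDF p. 236)]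
[cite: VoisinHodgeII2003, §1.2.3 Cor. 1.24 (PDF p. 62)] -/
theorem picardNumber_tensor_eq_one_add (hYh : IsSmoothHypersurface m e Y) (hm : 3 ≤ m) (hHD : exists_isReal_hodgeModel) (hZ : IsSmoothProjective n Z) (hYZ : IsSmoothProjective k (Y ⊗ Z)) :
    Module.finrank ℚ ↥((BettiUniverse.hodge hHD hYZ 2).hodgeClasses 1) = 1 + Module.finrank ℚ ↥((BettiUniverse.hodge hHD hZ 2).hodgeClasses 1) := by
  rw [hYh.picardNumber_tensor_eq_add (by omega) hHD hZ hYZ, hYh.finrank_hodgeClasses_hodge_two_eq_one hm hHD hYh.1]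

/-- **`ρ(Z × Y) = ρ(Z) + 1`**, the hypersurface `Y` (`dim ≥ 3`) on the right. [cite: VoisinHodgeI2002, §11.3.3 Thm. 11.38 and Lemma 11.41 (PDF p. 236)] [cite: VoisinHodgeII2003, §1.2.3 Cor. 1.24 (PDF p. 62)] -/
theorem picardNumber_tensor_eq_add_one (hYh : IsSmoothHypersurface m e Y) (hm : 3 ≤ m) (hHD : exists_isReal_hodgeModel) (hZ : IsSmoothProjective n Z) (hZY : IsSmoothProjective k (Z ⊗ Y)) :
    Module.finrank ℚ ↥((BettiUniverse.hodge hHD hZY 2).hodgeClasses 1) = Module.finrank ℚ ↥((BettiUniverse.hodge hHD hZ 2).hodgeClasses 1) + 1 := by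
  rw [hYh.picardNumber_tensor_eq_add_right (by omega) hHD hZ hZY, hYh.finrank_hodgeClasses_hodge_two_eq_one hm hHD hYh.1]

/-- **Two smooth hypersurfaces of dimensions `≥ 3`: `ρ(Y × Y′) = 2`.** [cite: VoisinHodgeI2002, §11.3.3 Thm. 11.38 and Lemma 11.41 (PDF p. 236)] [cite: VoisinHodgeII2003, §1.2.3 Cor. 1.24 (PDF p. 62)] -/
theorem picardNumber_tensor_eq_two {e' : ℕ} {Y' : SchemeOver ℂ} (hYh : IsSmoothHypersurface m e Y) (hm : 3 ≤ m) (hYh' : IsSmoothHypersurface n e' Y') (hn : 3 ≤ n) (hHD : exists_isReal_hodgeModel)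
    (hYY' : IsSmoothProjective k (Y ⊗ Y')) : Module.finrank ℚ ↥((BettiUniverse.hodge hHD hYY' 2).hodgeClasses 1) = 2 := by
  rw [hYh.picardNumber_tensor_eq_one_add hm hHD hYh'.1 hYY', hYh'.finrank_hodgeClasses_hodge_two_eq_one hn hHD hYh'.1]

/-- **A smooth hypersurface of dimension `≥ 3` times a smooth projective curve: `ρ(Y × C) = 2`** (`ρ(C) = 1`). [cite: VoisinHodgeI2002, §11.3.3 Thm. 11.38 and Lemma 11.41 (PDF p. 236); §11.3.1 Thm. 11.30]
[cite: Arapura2012, §11.2 (PDF p. 177)] -/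
theorem picardNumber_tensor_curve_eq_two (hYh : IsSmoothHypersurface m e Y) (hm : 3 ≤ m) (hHD : exists_isReal_hodgeModel) (hC : IsSmoothProjective 1 C) (hYC : IsSmoothProjective k (Y ⊗ C)) :
    Module.finrank ℚ ↥((BettiUniverse.hodge hHD hYC 2).hodgeClasses 1) = 2 := by
  rw [hYh.picardNumber_tensor_eq_one_add hm hHD hC hYC, BettiUniverse.picardNumber_curve hHD hC]

/-- **A smooth hypersurface of dimension `≥ 3` times a smooth surface `S_d ⊂ ℙ³`: `ρ(Y × S_d) = 1 + ρ(S_d)`.** [cite: VoisinHodgeI2002, §11.3.3 Thm. 11.38 and Lemma 11.41 (PDF p. 236)]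
[cite: VoisinHodgeII2003, §1.2.3 Cor. 1.24 (PDF p. 62)] -/
theorem picardNumber_tensor_surface_eq (hYh : IsSmoothHypersurface m e Y) (hm : 3 ≤ m) (hS : IsSmoothHypersurface 2 d S) (hHD : exists_isReal_hodgeModel) (hYS : IsSmoothProjective k (Y ⊗ S)) :
    Module.finrank ℚ ↥((BettiUniverse.hodge hHD hYS 2).hodgeClasses 1) = 1 + Module.finrank ℚ ↥((BettiUniverse.hodge hHD hS.1 2).hodgeClasses 1) :=
  hYh.picardNumber_tensor_eq_one_add hm hHD hS.1 hYS

/-- **… hence `ρ(Y × S_d) ≤ 1 + h^{1,1}(S_d) = 1 + (d³ − 4d² + 6d − 2 − 2·C(d−1, 3))`** (e.g. `≤ 21` for a quartic surface). [cite: VoisinHodgeI2002, §11.3.3 Thm. 11.38 and Lemma 11.41 (PDF p. 236)]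
[cite: EisenbudHarris2016, Example 5.24 and Table 5.1 (PDF p. 210–211)] [cite: Arapura2012, §17.3 (17.3.1) (PDF p. 249)] -/
theorem picardNumber_tensor_surface_le (hYh : IsSmoothHypersurface m e Y) (hm : 3 ≤ m) (hS : IsSmoothHypersurface 2 d S) (hHD : exists_isReal_hodgeModel) (hYS : IsSmoothProjective k (Y ⊗ S)) :
    Module.finrank ℚ ↥((BettiUniverse.hodge hHD hYS 2).hodgeClasses 1) ≤ 1 + (d ^ 3 + 6 * d - (4 * d ^ 2 + 2) - 2 * (d - 1).choose 3) := by
  rw [hYh.picardNumber_tensor_surface_eq hm hS hHD hYS]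
  exact Nat.add_le_add_left (hS.finrank_hodgeClasses_two_surface_le hHD) 1

/-- **A smooth surface `S_d ⊂ ℙ³` times any `Z`: `ρ(S_d × Z) = ρ(S_d) + ρ(Z)`** (`q(S_d) = 0`). [cite: VoisinHodgeI2002, §11.3.3 Thm. 11.38 and Lemma 11.41 (PDF p. 236), p. 287]
[cite: VoisinHodgeII2003, §1.2.3 Cor. 1.24 (PDF p. 62)] -/
theorem picardNumber_surface_tensor_eq_add (hS : IsSmoothHypersurface 2 d S) (hHD : exists_isReal_hodgeModel) (hZ : IsSmoothProjective n Z) (hSZ : IsSmoothProjective k (S ⊗ Z)) :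
    Module.finrank ℚ ↥((BettiUniverse.hodge hHD hSZ 2).hodgeClasses 1) =
      Module.finrank ℚ ↥((BettiUniverse.hodge hHD hS.1 2).hodgeClasses 1) + Module.finrank ℚ ↥((BettiUniverse.hodge hHD hZ 2).hodgeClasses 1) :=
  hS.picardNumber_tensor_eq_add le_rfl hHD hZ hSZ

/-- **Two smooth cubic surfaces: `ρ(S × S′) = 7 + 7 = 14`.** [cite: EisenbudHarris2016, Example 5.24 and Table 5.1 (PDF p. 210–211)] [cite: VoisinHodgeI2002, §11.3.3 Thm. 11.38 and Lemma 11.41 (PDF p. 236)] -/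
theorem picardNumber_tensor_cubicSurfaces {S' : SchemeOver ℂ} (hS : IsSmoothHypersurface 2 3 S) (hS' : IsSmoothHypersurface 2 3 S') (hHD : exists_isReal_hodgeModel)
    (hSS' : IsSmoothProjective k (S ⊗ S')) : Module.finrank ℚ ↥((BettiUniverse.hodge hHD hSS' 2).hodgeClasses 1) = 14 := by
  rw [hS.picardNumber_surface_tensor_eq_add hHD hS'.1 hSS', hS.finrank_hodgeClasses_two_cubicSurface hHD, hS'.finrank_hodgeClasses_two_cubicSurface hHD]

/-- **Two smooth quartic surfaces: `ρ(S × S′) = ρ(S) + ρ(S′) ≤ 40`.** [cite: Huybrechts2016K3, Ch. 1 §2.3 and §3.3] [cite: VoisinHodgeI2002, §11.3.3 Thm. 11.38 and Lemma 11.41 (PDF p. 236)] -/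
theorem picardNumber_tensor_quarticSurfaces_le {S' : SchemeOver ℂ} (hS : IsSmoothHypersurface 2 4 S) (hS' : IsSmoothHypersurface 2 4 S') (hHD : exists_isReal_hodgeModel)
    (hSS' : IsSmoothProjective k (S ⊗ S')) : Module.finrank ℚ ↥((BettiUniverse.hodge hHD hSS' 2).hodgeClasses 1) ≤ 40 := by
  rw [hS.picardNumber_surface_tensor_eq_add hHD hS'.1 hSS']
  have h1 := hS.finrank_hodgeClasses_two_quarticSurface_le hHD
  have h2 := hS'.finrank_hodgeClasses_two_quarticSurface_le hHD
  omega

end Picard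

end Literature.AlgebraicGeometry.Motives.IsSmoothHypersurface

end
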